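import Mathlib.LinearAlgebra.Projectivization.Basic
import Mathlib.FieldTheory.IntermediateField.Adjoin.Basic
import Mathlib.Algebra.Algebra.Rat
import Literature.NumberTheory.EllipticCurves.HeightsBaseChangeProofs
import HarnessLib

/-!
# Small value estimates at rational translates (Nguyen–Roy 2016) — proofs, XV: the absolute Weil height of an algebraic point of `ℙ²(ℂ)`

Fifteenth proofs file towards `Literature.NumberTheory.Transcendental.nguyenRoy2016_thm_1` (Nguyen–Roy,
IJNT 12 (2016) = arXiv:1412.5163). Everything here is PROVED; no named facts. §4 of the paper works
with zero-dimensional `ℚ`-subvarieties `Z` of `ℙ²`, i.e. Galois orbits of algebraic points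
`α ∈ ℙ²(ℚ̄)`, and with their heights; the comparison behind Lemma 11 is with "the absolute
logarithmic Weil height `h_abs(α)`" of a point of `Z`. This file defines that height for points of
`ℙ²(ℂ) = Projectivization ℂ (Fin 3 → ℂ)` and proves that it is well defined:

* `NFPres p` — a presentation of the point `p` over a number field: a number field `K`, an
  embedding `ι : K → ℂ` and homogeneous coordinates `a ∈ K³` with `[ι(a)] = p`;
  `IsAlgPt p` — `p` has one (i.e. `p ∈ ℙ²(ℚ̄)`);
* `logHeight_comp_div_finrank` — for any ring homomorphism `f : K → L` of number fields and any
  tuple `x`, `h_L(f ∘ x)/[L:ℚ] = h_K(x)/[K:ℚ]` (from the tree's base-change formula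
  `NumberField.logHeight_comp_algebraMap`, `H_L = H_K^{[L:K]}`);
* `NFPres.habs P = h_K(a)/[K:ℚ]` and **`NFPres.habs_eq_habs`**: two presentations of the same
  point give the same value (pass to the compositum inside `ℂ` of the two embedded fields, where
  the two coordinate vectors are proportional, and use the previous item and the projective
  invariance `Height.logHeight_smul_eq_logHeight`);
* `habs p` — the absolute logarithmic Weil height of `p` (`0` for non-algebraic `p`),
  `habs_eq : habs p = h_K(a)/[K:ℚ]` for every presentation, `habs_nonneg`.

With `deg(Z) = #Z` points this gives the height `∑_{α ∈ Z} h_abs(α) = deg(Z) h_abs(α)` used for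
`NguyenRoy.EndgameData.ht` (NR §4: `|h(Z) − deg(Z) h_abs(α)| ≤ c deg(Z)` for the Chow-form height
`h(Z)`; the endgame only needs a height up to such `O(deg Z)` discrepancies).

## References

* [NguyenRoy2016] N. A. V. Nguyen, D. Roy, IJNT 12 (2016) 1273–1293 = arXiv:1412.5163, §4 (heights
  of zero-dimensional subvarieties, `h_abs`, proof of Lemma 11).
* [SilvermanAEC2009] J. H. Silverman, *The Arithmetic of Elliptic Curves*, GTM 106, Prop. VIII.5.4
  (the height does not depend on the field: `H_L = H_K^{[L:K]}`).
-/

noncomputable section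

open Height Module

namespace Literature.NumberTheory.Transcendental

namespace NguyenRoy

universe u

/-! ### The absolute height is independent of the field -/

section indep

variable {K L : Type*} [Field K] [NumberField K] [Field L] [NumberField L]

/-- **Independence of the absolute height of the field**, tuple version: for a ring homomorphism
`f : K → L` of number fields and `x ∈ Kⁿ`, `h_L(f ∘ x)/[L:ℚ] = h_K(x)/[K:ℚ]`.
[cite: SilvermanAEC2009, Prop. VIII.5.4(b)] -/
theorem logHeight_comp_div_finrank (f : K →+* L) {ι : Type*} [Finite ι] (x : ι → K) :
    logHeight (fun i => f (x i)) / finrank ℚ L = logHeight x / finrank ℚ K := by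
  letI : Algebra K L := f.toAlgebra
  haveI : IsScalarTower ℚ K L := IsScalarTower.of_algebraMap_eq fun q => by
    rw [RingHom.algebraMap_toAlgebra, eq_ratCast, eq_ratCast, map_ratCast]
  have h := NumberField.logHeight_comp_algebraMap (K := K) (L := L) x
  have htower : (finrank ℚ L : ℝ) = finrank ℚ K * finrank K L := by
    exact_mod_cast (Module.finrank_mul_finrank ℚ K L).symm
  have hK : (0 : ℝ) < finrank ℚ K := by exact_mod_cast Module.finrank_pos
  have hKL : (0 : ℝ) < finrank K L := by exact_mod_cast Module.finrank_pos
  rw [show (fun i => f (x i)) = algebraMap K L ∘ x from rfl, h, htower]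
  field_simp

end indep

/-! ### Presentations of a point of `ℙ²(ℂ)` over a number field -/

/-- A presentation of the point `p ∈ ℙ²(ℂ)` over a number field: a number field `K`, an embedding
`ι : K → ℂ` and homogeneous coordinates `a ∈ K³` of `p`. [cite: NguyenRoy2016, §4] -/
structure NFPres (p : Projectivization ℂ (Fin 3 → ℂ)) : Type (u + 1) where
  /-- The number field. -/
  K : Type u
  [instField : Field K]
  [instNumberField : NumberField K]
  /-- The embedding into `ℂ`. -/
  ι : K →+* ℂ
  /-- Homogeneous coordinates in `K³`. -/
  a : Fin 3 → K
  ne_zero : (fun j => ι (a j)) ≠ 0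
  mk_eq : Projectivization.mk ℂ (fun j => ι (a j)) ne_zero = p

attribute [instance] NFPres.instField NFPres.instNumberField

/-- `p ∈ ℙ²(ℚ̄)`: the point has a presentation over a number field. [cite: NguyenRoy2016, §4] -/
def IsAlgPt (p : Projectivization ℂ (Fin 3 → ℂ)) : Prop := Nonempty (NFPres.{0} p)

namespace NFPres

variable {p : Projectivization ℂ (Fin 3 → ℂ)}

/-- The value `h_K(a)/[K:ℚ]` of a presentation. [cite: NguyenRoy2016, §4 (h_abs)] -/
def habs (P : NFPres p) : ℝ := logHeight P.a / finrank ℚ P.K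

/-- `0 ≤ h_K(a)/[K:ℚ]`. [folklore] -/
theorem habs_nonneg (P : NFPres p) : 0 ≤ P.habs :=
  div_nonneg (logHeight_nonneg _) (Nat.cast_nonneg _)

/-- The coordinate vector of a presentation is nonzero. [folklore] -/
theorem a_ne_zero (P : NFPres p) : P.a ≠ 0 := by
  intro h
  apply P.ne_zero
  funext j
  simp [h]

/-- The embedded field `ι(K) ⊆ ℂ` of a presentation, as an intermediate field. [folklore] -/
def E (P : NFPres p) : IntermediateField ℚ ℂ := (P.ι.toRatAlgHom).fieldRange

/-- `ι(x) ∈ ι(K)`. [folklore] -/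
theorem mem_E (P : NFPres p) (x : P.K) : P.ι x ∈ P.E :=
  ⟨x, by simp⟩

/-- `ι(K)` is finite-dimensional over `ℚ`. [folklore] -/
instance finiteDimensional_E (P : NFPres p) : FiniteDimensional ℚ P.E := by
  have h : FiniteDimensional ℚ (Subalgebra.toSubmodule (P.ι.toRatAlgHom).range) :=
    (P.ι.toRatAlgHom).toLinearMap.finiteDimensional_range
  rw [← AlgHom.fieldRange_toSubalgebra] at h
  exact h

/-- A finite-dimensional intermediate field of `ℂ/ℚ` is a number field. [folklore] -/
theorem numberField_of_intermediateField (E : IntermediateField ℚ ℂ) [FiniteDimensional ℚ E] :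
    NumberField E :=
  { to_charZero := charZero_of_injective_algebraMap (algebraMap ℚ E).injective
    to_finiteDimensional := ‹_› }

/-- **The absolute height of a point does not depend on the presentation.** For two presentations
`(K, ι, a)`, `(K', ι', a')` of the same point of `ℙ²(ℂ)`, `h_K(a)/[K:ℚ] = h_{K'}(a')/[K':ℚ]`.
[cite: NguyenRoy2016, §4 (h_abs is well defined); SilvermanAEC2009, Prop. VIII.5.4] -/
theorem habs_eq_habs (P Q : NFPres p) : P.habs = Q.habs := by
  -- the compositum `L = ι(K) ι'(K') ⊆ ℂ`
  let L : IntermediateField ℚ ℂ := P.E ⊔ Q.E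
  haveI : FiniteDimensional ℚ L := IntermediateField.finiteDimensional_sup P.E Q.E
  haveI : NumberField L := numberField_of_intermediateField L
  have hPL : ∀ x, P.ι x ∈ L := fun x => (le_sup_left : P.E ≤ L) (P.mem_E x)
  have hQL : ∀ x, Q.ι x ∈ L := fun x => (le_sup_right : Q.E ≤ L) (Q.mem_E x)
  let fP : P.K →+* L := P.ι.codRestrict L hPL
  let fQ : Q.K →+* L := Q.ι.codRestrict L hQL
  have hfP : ∀ x, ((fP x : L) : ℂ) = P.ι x := fun x => rfl
  have hfQ : ∀ x, ((fQ x : L) : ℂ) = Q.ι x := fun x => rfl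
  -- the two coordinate vectors are proportional in `L`
  obtain ⟨c, hc⟩ := (Projectivization.mk_eq_mk_iff' ℂ _ _ P.ne_zero Q.ne_zero).mp
    (P.mk_eq.trans Q.mk_eq.symm)
  -- `hc : c • (ι' a') = ι a`
  have hcj : ∀ j, c * Q.ι (Q.a j) = P.ι (P.a j) := fun j => by
    have := congrFun hc j
    simpa using this
  obtain ⟨j₀, hj₀⟩ : ∃ j, Q.ι (Q.a j) ≠ 0 := by
    by_contra h
    push Not at h
    exact Q.ne_zero (funext h)
  have hcval : c = P.ι (P.a j₀) / Q.ι (Q.a j₀) := by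
    rw [eq_div_iff hj₀]; exact hcj j₀
  have hcL : c ∈ L := by rw [hcval]; exact div_mem (hPL _) (hQL _)
  have hc0 : c ≠ 0 := by
    rintro rfl
    apply P.ne_zero
    funext j
    rw [← hcj j, zero_mul]
    rfl
  set cL : L := ⟨c, hcL⟩ with hcLdef
  have hcL0 : cL ≠ 0 := fun h => hc0 (by rw [hcLdef] at h; exact congrArg Subtype.val h)
  have hvec : (fun j => fP (P.a j)) = cL • (fun j => fQ (Q.a j)) := by
    funext j
    apply Subtype.ext
    rw [hfP, Pi.smul_apply, smul_eq_mul]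
    change P.ι (P.a j) = c * ((fQ (Q.a j) : L) : ℂ)
    rw [hfQ, hcj]
  -- compare through `L`
  have hP := logHeight_comp_div_finrank fP P.a
  have hQ := logHeight_comp_div_finrank fQ Q.a
  rw [habs, habs, ← hP, ← hQ, hvec, logHeight_smul_eq_logHeight _ hcL0]

end NFPres

/-! ### The absolute logarithmic Weil height of a point of `ℙ²(ℂ)` -/

/-- The absolute logarithmic Weil height `h_abs(p)` of a point `p ∈ ℙ²(ℂ)`: `h_K(a)/[K:ℚ]` for any
presentation `(K, ι, a)` of `p` over a number field (`0` if `p ∉ ℙ²(ℚ̄)`).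
[cite: NguyenRoy2016, §4 (h_abs)] -/
def habs (p : Projectivization ℂ (Fin 3 → ℂ)) : ℝ := by
  classical
  exact if h : IsAlgPt p then (Classical.choice h).habs else 0

/-- `h_abs(p)` is computed by ANY presentation (in universe `0`). [cite: NguyenRoy2016, §4] -/
theorem habs_eq {p : Projectivization ℂ (Fin 3 → ℂ)} (P : NFPres.{0} p) : habs p = P.habs := by
  unfold habs
  rw [dif_pos ⟨P⟩]
  exact NFPres.habs_eq_habs _ _

/-- `h_abs(p) = h_K(a)/[K:ℚ]` for a number field `K` (in `Type`), an embedding `ι` and coordinates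
`a` of `p`. [cite: NguyenRoy2016, §4] -/
theorem habs_mk {K : Type} [Field K] [NumberField K] (ι : K →+* ℂ) (a : Fin 3 → K)
    (ha : (fun j => ι (a j)) ≠ 0) :
    habs (Projectivization.mk ℂ (fun j => ι (a j)) ha) = logHeight a / finrank ℚ K :=
  habs_eq (⟨K, ι, a, ha, rfl⟩ : NFPres _)

/-- `0 ≤ h_abs(p)`. [folklore] -/
theorem habs_nonneg (p : Projectivization ℂ (Fin 3 → ℂ)) : 0 ≤ habs p := by
  unfold habs
  split_ifs with h
  · exact (Classical.choice h).habs_nonneg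
  · exact le_rfl

/-- **Galois invariance**: conjugate presentations have the same absolute height: for
`σ : K →+* K`, `h_K(σ ∘ a)/[K:ℚ] = h_K(a)/[K:ℚ]`. [cite: NguyenRoy2016, §4] -/
theorem logHeight_comp_self_div_finrank {K : Type*} [Field K] [NumberField K] (σ : K →+* K)
    (a : Fin 3 → K) : logHeight (fun i => σ (a i)) / finrank ℚ K = logHeight a / finrank ℚ K :=
  logHeight_comp_div_finrank σ a

end NguyenRoy

end Literature.NumberTheory.Transcendental

end
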